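import Summits.CriticalPhenomena.PercolationContinuityZ3.Theorems.SoloBlindSlitRate
import Summits.CriticalPhenomena.PercolationContinuityZ3.Theorems.SoloBlindSlitDeep
import Summits.CriticalPhenomena.PercolationContinuityZ3.Theorems.SoloBlindChainBK
import Summits.CriticalPhenomena.PercolationContinuityZ3.Theorems.SoloBlindPeriodicFinRate
import Literature.Probability.Percolation.BKFinitary
import Literature.Probability.Percolation.InequalitiesProofs
import HarnessLib

/-!
# Double connections across a free wall: the reflection lower bound

Seat `solo-CriticalPhenomena-blind`, toward `PercolationContinuityZ3` (`θ(p_c) = 0` for bond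
percolation on `ℤ³`).

For sites `x, y` of `ℤ³` let `{x ⇉ y} = {x ↔ y} □ {x ↔ y}` (`dconn x y`) be the event that `x` and `y`
are joined by two EDGE-DISJOINT open paths — the disjoint occurrence of the connection event with
itself (the "backbone" two-point event).  Write `ℍ = {0 ≤ x₀}` (`hsp`), `a = (0,0,0)`, `b = (0,0,w)`
(`cpt true 0`, `cpt true w`), and `a* = (-1,0,0)`, `b* = (-1,0,w)` for their neighbours across the
wall (`cpt false 0`, `cpt false w`).

* `sq_mul_sq_le_real_dconn` — **the reflection lower bound**, for every `p`:
  `p² · P_p(a ↔ b inside ℍ)² ≤ P_p(a ⇉ b)`.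
  Proof.  The reflection `u ↦ (-1-u₀, u₁, u₂)` (`reflIso`) carries `ℍ* = {x₀ ≤ -1}` onto `ℍ`, so
  `P_p(a* ↔ b* inside ℍ*) = P_p(a ↔ b inside ℍ)`.  The four events `{a ↔ b in ℍ}`, `{a* ↔ b* in ℍ*}`,
  `{aa* open}`, `{bb* open}` are increasing, hence (Harris–FKG) occur together with probability
  `≥ p² P_p(a ↔ b in ℍ)²`; and when they do, the open `ℍ`-path and the open path `a, a*, (ℍ*-path),
  b*, b` are edge-disjoint (`inter_subset_dconn`).
* `real_dconn_le_sq` — the BK upper bound `P_p(x ⇉ y) ≤ P_p(x ↔ y)²` (tree: `bk_finitary`,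
  `isFinitary_openConnVia`).
* At `p = p_c(ℤ³)`: `pcE_sq_mul_tauH_sq_le_dconn` (`p_c² τ_ℍ(w)² ≤ P_{p_c}(0 ⇉ (0,0,w))`), hence
  **`lineRate_of_summable_sqrt_dconn`: `Σ_{z ∈ ℤ} √P_{p_c}(0 ⇉ (0,0,z)) < ∞ ⟹ LineRate`**, and then
  the tree's `periodicFin_of_lineRate` / `slit_of_lineRate` give the periodic-fin and slit rungs
  (`periodicFin_of_summable_sqrt_dconn`, `slit_of_summable_sqrt_dconn`).

So the half-space line sum `T₀ = Σ_w τ_ℍ(w)` driving the rungs of this lineage is controlled by a BULK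
quantity with no wall in it, the square-root line sum of the backbone two-point function.
(Heuristically `P_{p_c}(0 ⇉ x) ≈ |x|^{-2(3 - d_B)}` with `d_B ≈ 1.86` the backbone dimension of
three-dimensional critical percolation, so the hypothesis asks for `3 - d_B > 1`; the plain two-point
function `≈ |x|^{-(1+η)}`, `η < 0`, has a divergent line sum, which is why the square — two disjoint
paths — is essential.)
-/

noncomputable section

namespace Summit.CriticalPhenomena.PercolationContinuityZ3.Theorems

open MeasureTheory Literature.Probability.Percolation Literature.Probability.LatticeModels
open scoped ENNReal

/-- The double-connection ("backbone") event `{x ⇉ y} = {x ↔ y} □ {x ↔ y}`: two edge-disjoint open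
paths of `ℤ³` from `x` to `y`. -/
def dconn (x y : Site 3) : Set (BondConfig (Site 3)) :=
  openConnVia (zdGraph 3) x y □ openConnVia (zdGraph 3) x y

/-! ### Small facts about the connector points -/

/-- `cpt true 0` is the origin. -/
theorem cpt_true_zero : cpt true 0 = (0 : Site 3) := by
  simp [cpt]

/-- Both endpoints of an edge of `withinGraph (zdGraph 3) R` lie in `R`. -/
theorem mem_of_mem_edgeSet_withinGraph {R : Set (Site 3)} :
    ∀ e : Sym2 (Site 3), e ∈ (withinGraph (zdGraph 3) R).edgeSet → ∀ u ∈ e, u ∈ R :=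
  Sym2.ind fun u v he x hx => by
    rw [mem_edgeSet_withinGraph] at he
    rcases Sym2.mem_iff.1 hx with rfl | rfl
    exacts [he.2.1, he.2.2]

/-! ### The deterministic step: two edge-disjoint open paths -/

/-- If `a ↔ b` inside `ℍ`, `a* ↔ b*` inside `ℍ* = {x₀ ≤ -1}`, and the two wall-crossing edges `aa*`,
`bb*` are open, then `a ⇉ b`: the witnesses `ω ∩ E(ℍ)` and `{aa*, bb*} ∪ (ω ∩ E(ℍ*))` are disjoint
sub-configurations each containing an open path from `a` to `b`. -/
theorem inter_subset_dconn (w : ℤ) (ω : BondConfig (Site 3))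
    (hA : ω ∈ openConnVia (withinGraph (zdGraph 3) hsp) (cpt true 0) (cpt true w))
    (hB : ω ∈ openConnVia (withinGraph (zdGraph 3) {x : Site 3 | x 0 ≤ -1}) (cpt false 0) (cpt false w))
    (hC : s(cpt true 0, cpt false 0) ∈ ω) (hD : s(cpt true w, cpt false w) ∈ ω) :
    ω ∈ dconn (cpt true 0) (cpt true w) := by
  have hU := isUpperSet_openConnVia (zdGraph 3) (cpt true 0) (cpt true w)
  refine (hU.mem_disjointOccurrence_iff hU ω).2
    ⟨ω ∩ (withinGraph (zdGraph 3) hsp).edgeSet, Set.inter_subset_left,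
      insert s(cpt true 0, cpt false 0) (insert s(cpt true w, cpt false w)
        (ω ∩ (withinGraph (zdGraph 3) {x : Site 3 | x 0 ≤ -1}).edgeSet)),
      Set.insert_subset hC (Set.insert_subset hD Set.inter_subset_left), ?_, ?_, ?_⟩
  · -- the two witnesses are disjoint: edges of `ℍ` have both endpoints in `{0 ≤ x₀}`, the others
    -- have an endpoint in `{x₀ ≤ -1}`
    refine Set.disjoint_left.2 fun e heK heL => ?_
    obtain ⟨-, heK⟩ := heK
    have hK := mem_of_mem_edgeSet_withinGraph e heK
    simp only [Set.mem_insert_iff, Set.mem_inter_iff] at heL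
    have h0 := cpt_false_apply_zero 0
    have hw := cpt_false_apply_zero w
    rcases heL with h | h | ⟨-, h⟩
    · have := hK (cpt false 0) (by rw [h]; exact Sym2.mem_mk_right _ _)
      change (0 : ℤ) ≤ cpt false 0 0 at this
      omega
    · have := hK (cpt false w) (by rw [h]; exact Sym2.mem_mk_right _ _)
      change (0 : ℤ) ≤ cpt false w 0 at this
      omega
    · have hL := mem_of_mem_edgeSet_withinGraph e h
      obtain ⟨u, hu⟩ : ∃ u, u ∈ e := ⟨_, Sym2.out_fst_mem e⟩
      have h1 := hK u hu
      have h2 := hL u hu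
      change (0 : ℤ) ≤ u 0 at h1
      change u 0 ≤ -1 at h2
      omega
  · -- `ω ∩ E(ℍ)` contains an open path from `a` to `b`
    change cpt true w ∈ openClusterIn (zdGraph 3) (ω ∩ (withinGraph (zdGraph 3) hsp).edgeSet) (cpt true 0)
    have h1 : cpt true w ∈
        openClusterIn (withinGraph (zdGraph 3) hsp) (ω ∩ (withinGraph (zdGraph 3) hsp).edgeSet) (cpt true 0) := by
      rw [openClusterIn_inter_edgeSet]; exact hA
    exact openClusterIn_mono_graph (withinGraph_le _ _) _ _ h1
  · -- `{aa*, bb*} ∪ (ω ∩ E(ℍ*))` contains the open path `a, a*, …, b*, b`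
    change cpt true w ∈ openClusterIn (zdGraph 3)
      (insert s(cpt true 0, cpt false 0) (insert s(cpt true w, cpt false w)
        (ω ∩ (withinGraph (zdGraph 3) {x : Site 3 | x 0 ≤ -1}).edgeSet))) (cpt true 0)
    have h1 : cpt false 0 ∈ openClusterIn (zdGraph 3)
        (insert s(cpt true 0, cpt false 0) (insert s(cpt true w, cpt false w)
          (ω ∩ (withinGraph (zdGraph 3) {x : Site 3 | x 0 ≤ -1}).edgeSet))) (cpt true 0) :=
      mem_openClusterIn_of_adj (self_mem_openClusterIn _ _ _) (cpt_adj 0) (Set.mem_insert _ _)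
    have h2 : cpt false w ∈ openClusterIn (zdGraph 3)
        (insert s(cpt true 0, cpt false 0) (insert s(cpt true w, cpt false w)
          (ω ∩ (withinGraph (zdGraph 3) {x : Site 3 | x 0 ≤ -1}).edgeSet))) (cpt false 0) := by
      have h3 : cpt false w ∈ openClusterIn (withinGraph (zdGraph 3) {x : Site 3 | x 0 ≤ -1})
          (ω ∩ (withinGraph (zdGraph 3) {x : Site 3 | x 0 ≤ -1}).edgeSet) (cpt false 0) := by
        rw [openClusterIn_inter_edgeSet]; exact hB
      refine openClusterIn_mono_graph (withinGraph_le _ _) _ _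
        (openClusterIn_mono_config _ ?_ _ h3)
      exact (Set.subset_insert _ _).trans (Set.subset_insert _ _)
    rw [openClusterIn_eq_of_mem h1] at h2
    refine mem_openClusterIn_of_adj h2 (cpt_adj w).symm ?_
    rw [show s(cpt false w, cpt true w) = s(cpt true w, cpt false w) from Sym2.eq_swap]
    exact Set.mem_insert_of_mem _ (Set.mem_insert _ _)

/-! ### Reflection invariance and Harris–FKG -/

/-- **Reflection.** `P_p(a* ↔ b* inside ℍ*) = P_p(a ↔ b inside ℍ)` for feet `a*, b*` and the
corresponding connectors `a, b` (every `p`; the tree's `measure_openConnVia_lower_eq` is the case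
`p = p_c`). -/
theorem real_openConnVia_lower_eq (p : unitInterval) (z z' : ℤ) :
    (bondPercolation (zdGraph 3) p).real
        (openConnVia (withinGraph (zdGraph 3) {x : Site 3 | x 0 ≤ -1}) (cpt false z) (cpt false z')) =
      (bondPercolation (zdGraph 3) p).real
        (openConnVia (withinGraph (zdGraph 3) hsp) (cpt true z) (cpt true z')) := by
  have hH : ∀ u, reflIso.toEquiv u ∈ hsp ↔ u ∈ {x : Site 3 | x 0 ≤ -1} := fun u => by
    simp only [hsp, Set.mem_setOf_eq, reflIso_apply_zero]; omega
  have hK : ∀ u v, (withinGraph (zdGraph 3) hsp).Adj (reflIso.toEquiv u) (reflIso.toEquiv v) ↔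
      (withinGraph (zdGraph 3) {x : Site 3 | x 0 ≤ -1}).Adj u v := by
    intro u v
    simp only [withinGraph_adj, hH, reflIso.map_rel_iff']
  have hpre := relabel_preimage_openConnVia reflIso.toEquiv hK (cpt false z) (cpt false z')
  have hreal := bondPercolation_real_preimage_relabel_iso reflIso p
    (openConnVia (withinGraph (zdGraph 3) hsp) (reflIso.toEquiv (cpt false z))
      (reflIso.toEquiv (cpt false z')))
  rw [hpre, reflIso_cpt_false, reflIso_cpt_false] at hreal
  exact hreal

/-- Harris–FKG for four increasing events. -/
theorem real_mul_four_le_inter (p : unitInterval) {A B C D : Set (BondConfig (Site 3))}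
    (hA : IsUpperSet A) (hB : IsUpperSet B) (hC : IsUpperSet C) (hD : IsUpperSet D)
    (hAm : MeasurableSet A) (hBm : MeasurableSet B) (hCm : MeasurableSet C) (hDm : MeasurableSet D) :
    (bondPercolation (zdGraph 3) p).real A * (bondPercolation (zdGraph 3) p).real B *
        ((bondPercolation (zdGraph 3) p).real C * (bondPercolation (zdGraph 3) p).real D) ≤
      (bondPercolation (zdGraph 3) p).real (A ∩ B ∩ (C ∩ D)) := by
  have h1 := harris_fkg_holds (zdGraph 3) p hA hB hAm hBm
  have h2 := harris_fkg_holds (zdGraph 3) p hC hD hCm hDm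
  have h3 := harris_fkg_holds (zdGraph 3) p (hA.inter hB) (hC.inter hD) (hAm.inter hBm) (hCm.inter hDm)
  exact (mul_le_mul h1 h2 (mul_nonneg measureReal_nonneg measureReal_nonneg) measureReal_nonneg).trans h3

/-! ### The reflection lower bound -/

/-- **Reflection lower bound for double connections.** For every `p` and every `w ∈ ℤ`:
`p² · P_p((0,0,0) ↔ (0,0,w) inside ℍ)² ≤ P_p((0,0,0) ⇉ (0,0,w))`. -/
theorem sq_mul_sq_le_real_dconn (p : unitInterval) (w : ℤ) :
    (p : ℝ) ^ 2 * ((bondPercolation (zdGraph 3) p).real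
        (openConnVia (withinGraph (zdGraph 3) hsp) (cpt true 0) (cpt true w))) ^ 2 ≤
      (bondPercolation (zdGraph 3) p).real (dconn (cpt true 0) (cpt true w)) := by
  have hincl : openConnVia (withinGraph (zdGraph 3) hsp) (cpt true 0) (cpt true w) ∩
      openConnVia (withinGraph (zdGraph 3) {x : Site 3 | x 0 ≤ -1}) (cpt false 0) (cpt false w) ∩
      ({ω : BondConfig (Site 3) | s(cpt true 0, cpt false 0) ∈ ω} ∩
        {ω : BondConfig (Site 3) | s(cpt true w, cpt false w) ∈ ω}) ⊆
      dconn (cpt true 0) (cpt true w) := by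
    rintro ω ⟨⟨hA, hB⟩, hC, hD⟩
    exact inter_subset_dconn w ω hA hB hC hD
  have hH := real_mul_four_le_inter p
    (isUpperSet_openConnVia (withinGraph (zdGraph 3) hsp) (cpt true 0) (cpt true w))
    (isUpperSet_openConnVia (withinGraph (zdGraph 3) {x : Site 3 | x 0 ≤ -1}) (cpt false 0) (cpt false w))
    (show IsUpperSet {ω : BondConfig (Site 3) | s(cpt true 0, cpt false 0) ∈ ω} from
      fun _ _ hle he => hle he)
    (show IsUpperSet {ω : BondConfig (Site 3) | s(cpt true w, cpt false w) ∈ ω} from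
      fun _ _ hle he => hle he)
    (measurableSet_openConnVia _ _ _) (measurableSet_openConnVia _ _ _)
    (measurable_set_mem _).setOf (measurable_set_mem _).setOf
  rw [real_openConnVia_lower_eq p 0 w,
    bondPercolation_cylinder (zdGraph 3) p ((SimpleGraph.mem_edgeSet _).2 (cpt_adj 0)),
    bondPercolation_cylinder (zdGraph 3) p ((SimpleGraph.mem_edgeSet _).2 (cpt_adj w))] at hH
  calc (p : ℝ) ^ 2 * ((bondPercolation (zdGraph 3) p).real
          (openConnVia (withinGraph (zdGraph 3) hsp) (cpt true 0) (cpt true w))) ^ 2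
        = (bondPercolation (zdGraph 3) p).real
            (openConnVia (withinGraph (zdGraph 3) hsp) (cpt true 0) (cpt true w)) *
          (bondPercolation (zdGraph 3) p).real
            (openConnVia (withinGraph (zdGraph 3) hsp) (cpt true 0) (cpt true w)) * ((p : ℝ) * p) := by
          ring
    _ ≤ _ := hH
    _ ≤ (bondPercolation (zdGraph 3) p).real (dconn (cpt true 0) (cpt true w)) :=
          measureReal_mono hincl (measure_ne_top _ _)

/-! ### The BK upper bound -/

/-- **BK upper bound**: `P_p(x ⇉ y) ≤ P_p(x ↔ y)²`. -/
theorem real_dconn_le_sq (p : unitInterval) (x y : Site 3) :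
    (bondPercolation (zdGraph 3) p).real (dconn x y) ≤
      (bondPercolation (zdGraph 3) p).real (openConnVia (zdGraph 3) x y) ^ 2 := by
  classical
  rw [sq]
  exact bk_finitary (zdGraph 3) p (isUpperSet_openConnVia _ _ _) (isUpperSet_openConnVia _ _ _)
    (isFinitary_openConnVia _ x y) (isFinitary_openConnVia _ x y)

/-! ### At `p_c`: the half-space line sum from the backbone two-point function -/

/-- At `p = p_c(ℤ³)`: `p_c² · τ_ℍ(w)² ≤ P_{p_c}(0 ⇉ (0,0,w))`. -/
theorem pcE_sq_mul_tauH_sq_le_dconn (w : ℤ) :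
    pcE ^ 2 * tauH w ^ 2 ≤ Pc (dconn 0 (Function.update (0 : Site 3) 2 w)) := by
  have h := sq_mul_sq_le_real_dconn (criticalProbI 3) w
  rw [cpt_true_zero] at h
  have hτ : tauH w = ENNReal.ofReal ((bondPercolation (zdGraph 3) (criticalProbI 3)).real
      (openConnVia (withinGraph (zdGraph 3) hsp) 0 (cpt true w))) := by
    rw [measureReal_def, ENNReal.ofReal_toReal (measure_ne_top _ _)]; rfl
  have hD : Pc (dconn 0 (Function.update (0 : Site 3) 2 w)) = ENNReal.ofReal
      ((bondPercolation (zdGraph 3) (criticalProbI 3)).real (dconn 0 (cpt true w))) := by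
    rw [measureReal_def, ENNReal.ofReal_toReal (measure_ne_top _ _)]; rfl
  rw [hτ, hD, pcE, ← ENNReal.ofReal_pow (criticalProbI 3).2.1, ← ENNReal.ofReal_pow measureReal_nonneg,
    ← ENNReal.ofReal_mul (sq_nonneg _)]
  exact ENNReal.ofReal_le_ofReal h

/-- `τ_ℍ(z) ≤ √P_{p_c}(0 ⇉ (0,0,z)) / p_c`, in real numbers. -/
theorem real_tauH_le_sqrt_dconn_div (z : ℤ) :
    (bondPercolation (zdGraph 3) (criticalProbI 3)).real
        (openConnVia (withinGraph (zdGraph 3) hsp) 0 (Function.update (0 : Site 3) 2 z)) ≤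
      (1 / (criticalProbI 3 : ℝ)) * Real.sqrt ((bondPercolation (zdGraph 3) (criticalProbI 3)).real
        (dconn 0 (Function.update (0 : Site 3) 2 z))) := by
  have hp : (0 : ℝ) < (criticalProbI 3 : ℝ) := by
    have := pcE_pos; unfold pcE at this; exact ENNReal.ofReal_pos.1 this
  have hz := sq_mul_sq_le_real_dconn (criticalProbI 3) z
  rw [cpt_true_zero] at hz
  change ((criticalProbI 3 : ℝ)) ^ 2 * ((bondPercolation (zdGraph 3) (criticalProbI 3)).real
      (openConnVia (withinGraph (zdGraph 3) hsp) 0 (Function.update (0 : Site 3) 2 z))) ^ 2 ≤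
    (bondPercolation (zdGraph 3) (criticalProbI 3)).real (dconn 0 (Function.update (0 : Site 3) 2 z)) at hz
  set t := (bondPercolation (zdGraph 3) (criticalProbI 3)).real
      (openConnVia (withinGraph (zdGraph 3) hsp) 0 (Function.update (0 : Site 3) 2 z)) with ht
  set D := (bondPercolation (zdGraph 3) (criticalProbI 3)).real
      (dconn 0 (Function.update (0 : Site 3) 2 z)) with hD
  have ht0 : 0 ≤ t := measureReal_nonneg
  have hmul : (criticalProbI 3 : ℝ) * t ≤ Real.sqrt D := by
    rw [← Real.sqrt_sq (mul_nonneg hp.le ht0), mul_pow]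
    exact Real.sqrt_le_sqrt hz
  calc t = (1 / (criticalProbI 3 : ℝ)) * ((criticalProbI 3 : ℝ) * t) := by
        field_simp
    _ ≤ (1 / (criticalProbI 3 : ℝ)) * Real.sqrt D :=
        mul_le_mul_of_nonneg_left hmul (by positivity)

/-- **`LineRate` from backbone summability.** If `Σ_{z ∈ ℤ} √P_{p_c}(0 ⇉ (0,0,z)) < ∞` then
`Σ_z P_{p_c}(0 ↔ (0,0,z) inside ℍ) < ∞` (`SoloBlindOpenRungs.LineRate`). -/
theorem lineRate_of_summable_sqrt_dconn
    (h : Summable fun z : ℤ => Real.sqrt ((bondPercolation (zdGraph 3) (criticalProbI 3)).real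
        (dconn 0 (Function.update (0 : Site 3) 2 z)))) :
    SoloBlindOpenRungs.LineRate := by
  unfold SoloBlindOpenRungs.LineRate
  refine Summable.of_nonneg_of_le (fun z => ENNReal.toReal_nonneg) (fun z => ?_)
    (h.mul_left (1 / (criticalProbI 3 : ℝ)))
  have := real_tauH_le_sqrt_dconn_div z
  rw [measureReal_def] at this
  exact this

/-- **Periodic fins from backbone summability**: under `Σ_z √P_{p_c}(0 ⇉ (0,0,z)) < ∞`, for all large
periods `M` the half-space with the half-plane `{x₁ = 0, x₀ ≤ -1}` glued on along the feet
`(-1,0,Mj)` does not percolate at `p_c(ℤ³)`. -/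
theorem periodicFin_of_summable_sqrt_dconn
    (h : Summable fun z : ℤ => Real.sqrt ((bondPercolation (zdGraph 3) (criticalProbI 3)).real
        (dconn 0 (Function.update (0 : Site 3) 2 z)))) :
    ∃ M₀ : ℕ, ∀ M : ℕ, M₀ ≤ M → ∀ h0 : (0 : Site 3) ∈ ({x : Site 3 | 0 ≤ x 0} ∪
        {x : Site 3 | (x 1 = 0 ∧ x 0 ≤ -2) ∨ (x 1 = 0 ∧ x 0 = -1 ∧ (M : ℤ) ∣ x 2)}),
      theta ((zdGraph 3).induce ({x : Site 3 | 0 ≤ x 0} ∪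
        {x : Site 3 | (x 1 = 0 ∧ x 0 ≤ -2) ∨ (x 1 = 0 ∧ x 0 = -1 ∧ (M : ℤ) ∣ x 2)})) ⟨0, h0⟩
        (criticalProbI 3) = 0 :=
  periodicFin_of_lineRate (lineRate_of_summable_sqrt_dconn h)

/-- **Slits from backbone summability**: under `Σ_z √P_{p_c}(0 ⇉ (0,0,z)) < ∞`, for all large
periods `M` the space with the wall `{x₀ = -1}` removed except for the pore sites `(-1,0,Mj)` does
not percolate at `p_c(ℤ³)`. -/
theorem slit_of_summable_sqrt_dconn
    (h : Summable fun z : ℤ => Real.sqrt ((bondPercolation (zdGraph 3) (criticalProbI 3)).real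
        (dconn 0 (Function.update (0 : Site 3) 2 z)))) :
    ∃ M₀ : ℕ, ∀ M : ℕ, M₀ ≤ M → ∀ h0 : (0 : Site 3) ∈ ({x : Site 3 | 0 ≤ x 0} ∪
        {x : Site 3 | x 0 ≤ -2 ∨ (x 0 = -1 ∧ x 1 = 0 ∧ (M : ℤ) ∣ x 2)}),
      theta ((zdGraph 3).induce ({x : Site 3 | 0 ≤ x 0} ∪
        {x : Site 3 | x 0 ≤ -2 ∨ (x 0 = -1 ∧ x 1 = 0 ∧ (M : ℤ) ∣ x 2)})) ⟨0, h0⟩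
        (criticalProbI 3) = 0 :=
  slit_of_lineRate (lineRate_of_summable_sqrt_dconn h)

end Summit.CriticalPhenomena.PercolationContinuityZ3.Theorems

end
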